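import Literature.RingTheory.KTheory.MilnorKTameSymbol
import Mathlib.Algebra.Order.Ring.Ordering.Basic
import Mathlib.Algebra.Ring.SumsOfSquares
import Mathlib.Order.Zorn
import Mathlib.Data.ZMod.Basic
import HarnessLib

/-!
# THEOREM 1.4: `−1` is a sum of squares in `F` iff `l(−1)` is nilpotent in `K_*F`
# (Milnor, *Algebraic K-theory and quadratic forms*, Invent. Math. 9 (1970), §1), with the ordering of a formally real field

Family `hodge`, lane `lit-hodgefound` (foundations library; seat `lit-hodgefound-p27`, generation 40, row g40-#4);
topic `RingTheory/KTheory`.  Sequel of `MilnorKGroups` (g39-#12: `MilnorK`, `symbol`, `lift`, Lemma 1.3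
`symbol_eq_zero_of_sum`) and `MilnorKTameSymbol` (g40-#1: the `cons`-calculus, `two_smul_cons_neg_one`); Mathlib's
`RingPreordering` (preorderings = subsemirings containing the squares and not `−1`) and `IsSumSq`.  DEFINITIONS WITH
BODIES (`sumSqPreordering`, `ringPreorderingChainSup`, `ringPreorderingAdjoin`, `sgnBit`, `sgnBitHom`,
`signMultilinear`, `signHomK`) and PROVED THEOREMS; no named fact, no instance, no notation, 0 `sorry`, net debt 0
(D-0026).

## The source, verbatim

J. Milnor, *Algebraic K-theory and quadratic forms*, Invent. Math. 9 (1970) 318–344 (held `paper:doi-10-1007-bf01425486`;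
bib key `Milnor1970`), §1 (p0003 L21–L52): «Here is an application. **THEOREM 1.4.** The element −1 is a sum of squares
in F if and only if every positive dimensional element of K_*F is nilpotent. *Proof.* If −1 is not a sum of squares,
then F can be embedded in a real closed field, and hence can be ordered. Choosing some fixed ordering, define an
n-linear mapping from K₁F × ⋯ × K₁F to the integers modulo 2 by the correspondence
l(a₁) × ⋯ × l(aₙ) ↦ (1 − sgn(a₁))/2 ⋯ (1 − sgn(aₙ))/2. Evidently the right hand side is zero whenever aᵢ + aᵢ₊₁ = 1.
Hence this correspondence induces a homomorphism K_nF → ℤ/2ℤ; which carries l(−1)ⁿ to 1. This proves that the element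
l(−1) is not nilpotent. Conversely, if say −1 = a₁² + ⋯ + a_r², then it follows from 1.3 that l(−a₁²)⋯l(−a_r²) = 0;
hence l(−1)^r ≡ 0 mod 2K_rF. Since 2l(−1) = 0, it follows immediately that l(−1)^{r+1} = 0. For any generator
γ = l(a₁)⋯l(aₙ) of the group K_nF, it follows from 1.2 that γ^s is equal to a multiple of l(−1)^{n(s−1)}γ. Hence
γ^s = 0 whenever n(s−1) > r. Similarly, for any sum γ₁ + ⋯ + γ_k of generators, the power (γ₁ + ⋯ + γ_k)^s can be
expressed as a linear combination of monomials γ₁^{i₁}⋯γ_k^{i_k} with i₁ + ⋯ + i_k = s. Choosing s > k, note that each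
such monomial is a multiple of l(−1)^{n(s−k)}. If s > k + r/n, it follows that (γ₁ + ⋯ + γ_k)^s = 0; which completes
the proof.»

## What is formalised

* §1 «F … can be ordered» — the Artin–Schreier step, proved here on Mathlib's `RingPreordering` (Mathlib has the
  notion but not the existence theorem): `sumSqPreordering` (the sums of squares, when `−1` is not one),
  `ringPreorderingChainSup` and **`exists_isMax_ringPreordering`** (Zorn), `ringPreorderingAdjoin` (`P + P·b` is a
  preordering when `−b ∉ P`), **`mem_or_neg_mem_of_isMax`** (a maximal preordering of a field is total), and
  **`exists_total_ringPreordering`**; the sign character of a total preordering: `sgnBit` (`(1 − sgn a)/2 ∈ ℤ/2ℤ`),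
  `sgnBit_mul`, `not_add_eq_one_of_not_mem` («the right hand side is zero whenever aᵢ + aᵢ₊₁ = 1»), `sgnBitHom`.
* §2 **THEOREM 1.4, `⇐`**: Milnor's `n`-linear map `signMultilinear`, the homomorphism **`signHomK n P hP : K_nF →+ ℤ/2ℤ`**,
  `signHomK_symbol_neg_one` («carries l(−1)ⁿ to 1»), **`symbol_neg_one_ne_zero`** (`l(−1)ⁿ ≠ 0` for all `n` when `−1`
  is not a sum of squares).
* §3 **THEOREM 1.4, `⇒`**: `exists_sum_units_mul_self_of_isSumSq`, `exists_symbol_neg_mul_self_eq` («l(−1)^r ≡ 0 mod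
  2K_rF»), **`symbol_neg_one_eq_zero_of_sum_eq`** («l(−1)^{r+1} = 0» from Lemma 1.3 and `2l(−1) = 0`),
  `symbol_neg_one_eq_zero_of_le`, **`exists_symbol_neg_one_eq_zero`**, and the equivalence **`isSumSq_neg_one_iff`**:
  `IsSumSq (−1 : F) ↔ ∃ r, {−1, …, −1} = 0 ∈ K_{r+1}F`.

Not here: the last step «for any generator γ … γ^s is equal to a multiple of l(−1)^{n(s−1)}γ … (γ₁ + ⋯ + γ_k)^s = 0»
(nilpotence of EVERY positive-dimensional element, which needs the bundled ring `K_*F`; the tree has the graded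
pieces `MilnorK F n` with the products `MilnorKRing.mul`).  The formalised equivalence is the pivot of the theorem:
both directions of Milnor's proof pass through the (non-)nilpotence of `l(−1)`.

## References

* [Milnor1970] J. Milnor, *Algebraic K-theory and quadratic forms*, Invent. Math. 9 (1970) 318–344 — §1 Theorem 1.4 and
  its proof (p0003 L21–L52); Lemma 1.3 (p0003 L5–L20).
* E. Artin, O. Schreier, *Algebraische Konstruktion reeller Körper*, Abh. Math. Sem. Hamburg 5 (1927) 85–99 — the
  ordering of a field in which `−1` is not a sum of squares (the step «F can be embedded in a real closed field, and
  hence can be ordered», here proved directly by Zorn's lemma on preorderings).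

Provenance: lane `lit-hodgefound`, seat `lit-hodgefound-p27` gen 40 (agent `literature-prover-lit-hodgefound-p27-g40-0`),
row g40-#4.
-/

set_option autoImplicit false

noncomputable section

namespace Literature.RingTheory.KTheory

/-! ### §1 Orderings: a field in which `−1` is not a sum of squares has a total preordering -/

section Ordering

variable {F : Type*} [Field F]

/-- **The sums of squares form a preordering when `−1` is not one of them** (the starting point of «F can be ordered»). [cite: Milnor1970, §1 proof of Theorem 1.4 «If −1 is not a sum of squares, then F can be embedded in a real closed field, and hence can be ordered» (p0003 L25–L26)] -/
def sumSqPreordering (h : ¬ IsSumSq (-1 : F)) : RingPreordering F where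
  __ := Subsemiring.sumSq F
  mem_of_isSquare' hx := by
    show _ ∈ Subsemiring.sumSq F
    rw [Subsemiring.mem_sumSq]; exact hx.isSumSq
  neg_one_notMem' hn := h (by
    have : (-1 : F) ∈ Subsemiring.sumSq F := hn
    rwa [Subsemiring.mem_sumSq] at this)

/-- The union of a non-empty chain of preorderings is a preordering (for Zorn's lemma). [cite: Milnor1970, §1 proof of Theorem 1.4 «If −1 is not a sum of squares, then F can be embedded in a real closed field, and hence can be ordered» (p0003 L25–L26)] -/
def ringPreorderingChainSup (c : Set (RingPreordering F)) (hc : IsChain (· ≤ ·) c) (hne : c.Nonempty) : RingPreordering F :=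
  RingPreordering.mk' (⋃ P ∈ c, (P : Set F))
    (fun {x y} hx hy => by
      rw [Set.mem_iUnion₂] at hx hy ⊢
      obtain ⟨P, hP, hxP⟩ := hx
      obtain ⟨Q, hQ, hyQ⟩ := hy
      rcases hc.total hP hQ with hPQ | hQP
      · exact ⟨Q, hQ, add_mem (hPQ hxP) hyQ⟩
      · exact ⟨P, hP, add_mem hxP (hQP hyQ)⟩)
    (fun {x y} hx hy => by
      rw [Set.mem_iUnion₂] at hx hy ⊢
      obtain ⟨P, hP, hxP⟩ := hx
      obtain ⟨Q, hQ, hyQ⟩ := hy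
      rcases hc.total hP hQ with hPQ | hQP
      · exact ⟨Q, hQ, mul_mem (hPQ hxP) hyQ⟩
      · exact ⟨P, hP, mul_mem hxP (hQP hyQ)⟩)
    (fun x => by
      obtain ⟨P, hP⟩ := hne
      rw [Set.mem_iUnion₂]
      exact ⟨P, hP, P.mem_of_isSquare ⟨x, rfl⟩⟩)
    (by
      rw [Set.mem_iUnion₂]
      rintro ⟨P, -, hP⟩
      exact P.neg_one_notMem' hP)

/-- The union bounds the chain. [cite: Milnor1970, §1 proof of Theorem 1.4 «If −1 is not a sum of squares, then F can be embedded in a real closed field, and hence can be ordered» (p0003 L25–L26)] -/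
theorem le_ringPreorderingChainSup {c : Set (RingPreordering F)} (hc : IsChain (· ≤ ·) c) (hne : c.Nonempty) {P : RingPreordering F}
    (hP : P ∈ c) : P ≤ ringPreorderingChainSup c hc hne := fun x hx => by
  show x ∈ (⋃ P ∈ c, (P : Set F))
  rw [Set.mem_iUnion₂]; exact ⟨P, hP, hx⟩

/-- **Zorn: a field with a preordering has a maximal preordering.** [cite: Milnor1970, §1 proof of Theorem 1.4 «If −1 is not a sum of squares, then F can be embedded in a real closed field, and hence can be ordered» (p0003 L25–L26)] -/
theorem exists_isMax_ringPreordering (P₀ : RingPreordering F) : ∃ P : RingPreordering F, IsMax P := by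
  haveI : Nonempty (RingPreordering F) := ⟨P₀⟩
  exact zorn_le_nonempty fun c hc hne => ⟨ringPreorderingChainSup c hc hne, fun P hP => le_ringPreorderingChainSup hc hne hP⟩

/-- Adjoining an element: for a preordering `P` and `b` with `−b ∉ P`, the set `P + P·b` is again a preordering (if `−1 = p + qb` then `q ≠ 0` and `−b = (1 + p)q/q² ∈ P`). [cite: Milnor1970, §1 proof of Theorem 1.4 «If −1 is not a sum of squares, then F can be embedded in a real closed field, and hence can be ordered» (p0003 L25–L26)] -/
def ringPreorderingAdjoin (P : RingPreordering F) (b : F) (hb : -b ∉ P) : RingPreordering F :=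
  RingPreordering.mk' {z | ∃ p ∈ P, ∃ q ∈ P, z = p + q * b}
    (by
      rintro x y ⟨p, hp, q, hq, rfl⟩ ⟨p', hp', q', hq', rfl⟩
      exact ⟨p + p', add_mem hp hp', q + q', add_mem hq hq', by ring⟩)
    (by
      rintro x y ⟨p, hp, q, hq, rfl⟩ ⟨p', hp', q', hq', rfl⟩
      exact ⟨p * p' + q * q' * (b * b), add_mem (mul_mem hp hp') (mul_mem (mul_mem hq hq') (P.mem_of_isSquare ⟨b, rfl⟩)),
        p * q' + p' * q, add_mem (mul_mem hp hq') (mul_mem hp' hq), by ring⟩)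
    (fun x => ⟨x * x, P.mem_of_isSquare ⟨x, rfl⟩, 0, zero_mem P, by ring⟩)
    (by
      rintro ⟨p, hp, q, hq, h⟩
      by_cases hq0 : q = 0
      · rw [hq0, zero_mul, add_zero] at h
        exact P.neg_one_notMem' (by rw [h]; exact hp)
      · -- `−b = (1 + p) q / q²`
        apply hb
        have hb' : -b = (1 + p) * q * (q⁻¹ * q⁻¹) := by
          field_simp
          linear_combination h
        rw [hb']
        exact mul_mem (mul_mem (add_mem (one_mem P) hp) hq) (P.mem_of_isSquare ⟨q⁻¹, rfl⟩))

/-- `P ≤ P + P·b`. [cite: Milnor1970, §1 proof of Theorem 1.4 «If −1 is not a sum of squares, then F can be embedded in a real closed field, and hence can be ordered» (p0003 L25–L26)] -/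
theorem le_ringPreorderingAdjoin (P : RingPreordering F) (b : F) (hb : -b ∉ P) : P ≤ ringPreorderingAdjoin P b hb :=
  fun x hx => ⟨x, hx, 0, zero_mem P, by ring⟩

/-- `b ∈ P + P·b`. [cite: Milnor1970, §1 proof of Theorem 1.4 «If −1 is not a sum of squares, then F can be embedded in a real closed field, and hence can be ordered» (p0003 L25–L26)] -/
theorem mem_ringPreorderingAdjoin (P : RingPreordering F) (b : F) (hb : -b ∉ P) : b ∈ ringPreorderingAdjoin P b hb :=
  ⟨0, zero_mem P, 1, one_mem P, by ring⟩

/-- **A maximal preordering of a field is total: `a ∈ P` or `−a ∈ P`** (the Artin–Schreier step behind «and hence can be ordered»). [cite: Milnor1970, §1 proof of Theorem 1.4 «If −1 is not a sum of squares, then F can be embedded in a real closed field, and hence can be ordered» (p0003 L25–L26)] -/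
theorem mem_or_neg_mem_of_isMax {P : RingPreordering F} (hP : IsMax P) (a : F) : a ∈ P ∨ -a ∈ P := by
  by_contra h
  rw [not_or] at h
  have hle := hP (le_ringPreorderingAdjoin P (-a) (by rw [neg_neg]; exact h.1))
  exact h.2 (hle (mem_ringPreorderingAdjoin P (-a) (by rw [neg_neg]; exact h.1)))

/-- **«If −1 is not a sum of squares, then F … can be ordered»**: there is a total preordering (a positive cone `P` with `P ∪ −P = F`, `P + P ⊆ P`, `PP ⊆ P`, `F² ⊆ P`, `−1 ∉ P`). [cite: Milnor1970, §1 proof of Theorem 1.4 «If −1 is not a sum of squares, then F can be embedded in a real closed field, and hence can be ordered» (p0003 L25–L26)] -/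
theorem exists_total_ringPreordering (h : ¬ IsSumSq (-1 : F)) :
    ∃ P : RingPreordering F, ∀ a : F, a ∈ P ∨ -a ∈ P := by
  obtain ⟨P, hP⟩ := exists_isMax_ringPreordering (sumSqPreordering h)
  exact ⟨P, mem_or_neg_mem_of_isMax hP⟩

/-! #### the sign character of a total preordering -/

/-- Two negatives multiply to a positive. [cite: Milnor1970, §1 proof of Theorem 1.4 (p0003 L26–L39)] -/
theorem mul_mem_of_not_mem {P : RingPreordering F} (hP : ∀ a : F, a ∈ P ∨ -a ∈ P) {a b : F} (ha : a ∉ P) (hb : b ∉ P) :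
    a * b ∈ P := by
  have ha' := (hP a).resolve_left ha
  have hb' := (hP b).resolve_left hb
  have := mul_mem ha' hb'
  rwa [neg_mul_neg] at this

/-- A non-zero positive times a negative is negative. [cite: Milnor1970, §1 proof of Theorem 1.4 (p0003 L26–L39)] -/
theorem mul_not_mem {P : RingPreordering F} {a b : F} (ha : a ∈ P) (ha0 : a ≠ 0) (hb : b ∉ P) : a * b ∉ P := by
  intro hab
  apply hb
  have : b = a * b * a * (a⁻¹ * a⁻¹) := by field_simp
  rw [this]
  exact mul_mem (mul_mem hab ha) (P.mem_of_isSquare ⟨a⁻¹, rfl⟩)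

/-- **«Evidently the right hand side is zero whenever aᵢ + aᵢ₊₁ = 1»**: two negatives do not add up to `1`. [cite: Milnor1970, §1 proof of Theorem 1.4 (p0003 L26–L39)] -/
theorem not_add_eq_one_of_not_mem {P : RingPreordering F} (hP : ∀ a : F, a ∈ P ∨ -a ∈ P) {a b : F} (ha : a ∉ P)
    (hb : b ∉ P) : a + b ≠ 1 := by
  intro h
  have := add_mem ((hP a).resolve_left ha) ((hP b).resolve_left hb)
  rw [← neg_add, h] at this
  exact P.neg_one_notMem' this

open Classical in
/-- **`(1 − sgn a)/2 ∈ ℤ/2ℤ`** for the chosen ordering: `1` if `a` is negative, `0` if positive. [cite: Milnor1970, §1 proof of Theorem 1.4 «l(a₁) × ⋯ × l(aₙ) ↦ (1 − sgn a₁)/2 ⋯ (1 − sgn aₙ)/2» (p0003 L27–L33)] -/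
def sgnBit (P : RingPreordering F) (a : Fˣ) : ZMod 2 := if (a : F) ∈ P then 0 else 1

/-- Positive elements have sign bit `0`. [cite: Milnor1970, §1 proof of Theorem 1.4 (p0003 L26–L39)] -/
theorem sgnBit_of_mem {P : RingPreordering F} {a : Fˣ} (h : (a : F) ∈ P) : sgnBit P a = 0 := if_pos h

/-- Negative elements have sign bit `1`. [cite: Milnor1970, §1 proof of Theorem 1.4 (p0003 L26–L39)] -/
theorem sgnBit_of_not_mem {P : RingPreordering F} {a : Fˣ} (h : (a : F) ∉ P) : sgnBit P a = 1 := if_neg h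

/-- `−1` is negative. [cite: Milnor1970, §1 proof of Theorem 1.4 (p0003 L26–L39)] -/
theorem sgnBit_neg_one (P : RingPreordering F) : sgnBit P (-1) = 1 := sgnBit_of_not_mem (by rw [Units.val_neg, Units.val_one]; exact P.neg_one_notMem')

/-- `sgn(ab) = sgn(a)sgn(b)`, additively in `ℤ/2ℤ`. [cite: Milnor1970, §1 proof of Theorem 1.4 (p0003 L26–L39)] -/
theorem sgnBit_mul {P : RingPreordering F} (hP : ∀ a : F, a ∈ P ∨ -a ∈ P) (a b : Fˣ) :
    sgnBit P (a * b) = sgnBit P a + sgnBit P b := by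
  by_cases ha : (a : F) ∈ P <;> by_cases hb : (b : F) ∈ P
  · rw [sgnBit_of_mem ha, sgnBit_of_mem hb, sgnBit_of_mem (by rw [Units.val_mul]; exact mul_mem ha hb), add_zero]
  · rw [sgnBit_of_mem ha, sgnBit_of_not_mem hb, sgnBit_of_not_mem (by rw [Units.val_mul]; exact mul_not_mem ha a.ne_zero hb),
      zero_add]
  · rw [sgnBit_of_not_mem ha, sgnBit_of_mem hb,
      sgnBit_of_not_mem (by rw [Units.val_mul, mul_comm]; exact mul_not_mem hb b.ne_zero ha), add_zero]
  · rw [sgnBit_of_not_mem ha, sgnBit_of_not_mem hb, sgnBit_of_mem (by rw [Units.val_mul]; exact mul_mem_of_not_mem hP ha hb)]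
    decide

/-- The sign bit as an additive map on `K₁F = F•` (so that Milnor's correspondence is `n`-linear). [cite: Milnor1970, §1 proof of Theorem 1.4 (p0003 L26–L39)] -/
def sgnBitHom (P : RingPreordering F) (hP : ∀ a : F, a ∈ P ∨ -a ∈ P) : Additive Fˣ →+ ZMod 2 :=
  AddMonoidHom.mk' (fun x => sgnBit P (Additive.toMul x)) fun x y => by rw [toMul_add, sgnBit_mul hP]

/-- Unfolding `sgnBitHom`. [cite: Milnor1970, §1 proof of Theorem 1.4 (p0003 L26–L39)] -/
theorem sgnBitHom_ofMul (P : RingPreordering F) (hP : ∀ a : F, a ∈ P ∨ -a ∈ P) (a : Fˣ) :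
    sgnBitHom P hP (Additive.ofMul a) = sgnBit P a := rfl

end Ordering

/-! ### §2 THEOREM 1.4, `⇐`: `l(−1)` is not nilpotent when `−1` is not a sum of squares -/

namespace MilnorK

variable {F : Type*} [Field F] {n : ℕ}

variable (n) in
/-- **Milnor's «n-linear mapping from K₁F × ⋯ × K₁F to the integers modulo 2», `l(a₁) × ⋯ × l(aₙ) ↦ ∏ (1 − sgn aᵢ)/2`.** [cite: Milnor1970, §1 proof of Theorem 1.4 (p0003 L26–L39)] -/
def signMultilinear (P : RingPreordering F) (hP : ∀ a : F, a ∈ P ∨ -a ∈ P) :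
    MultilinearMap ℤ (fun _ : Fin n => Additive Fˣ) (ZMod 2) :=
  (MultilinearMap.mkPiAlgebra ℤ (Fin n) (ZMod 2)).compLinearMap fun _ => (sgnBitHom P hP).toIntLinearMap

/-- Its value is the product of the sign bits. [cite: Milnor1970, §1 proof of Theorem 1.4 (p0003 L26–L39)] -/
theorem signMultilinear_apply (P : RingPreordering F) (hP : ∀ a : F, a ∈ P ∨ -a ∈ P) (a : Fin n → Fˣ) :
    signMultilinear n P hP (fun j => Additive.ofMul (a j)) = ∏ j, sgnBit P (a j) := by
  rw [signMultilinear, MultilinearMap.compLinearMap_apply, MultilinearMap.mkPiAlgebra_apply]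
  rfl

variable (n) in
/-- **«Hence this correspondence induces a homomorphism K_nF → ℤ/2ℤ»**. [cite: Milnor1970, §1 proof of Theorem 1.4 (p0003 L26–L39)] -/
def signHomK (P : RingPreordering F) (hP : ∀ a : F, a ∈ P ∨ -a ∈ P) : MilnorK F n →+ ZMod 2 :=
  lift (signMultilinear n P hP) (by
    intro a i h hsum
    rw [signMultilinear_apply]
    by_cases hi : (a i : F) ∈ P
    · exact Finset.prod_eq_zero (Finset.mem_univ i) (sgnBit_of_mem hi)
    · have hi1 : (a (finSucc i h) : F) ∈ P := by
        by_contra h1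
        exact not_add_eq_one_of_not_mem hP hi h1 hsum
      exact Finset.prod_eq_zero (Finset.mem_univ _) (sgnBit_of_mem hi1))

/-- Its value on a symbol. [cite: Milnor1970, §1 proof of Theorem 1.4 (p0003 L26–L39)] -/
theorem signHomK_symbol (P : RingPreordering F) (hP : ∀ a : F, a ∈ P ∨ -a ∈ P) (a : Fin n → Fˣ) :
    signHomK n P hP (symbol a) = ∏ j, sgnBit P (a j) := by
  rw [signHomK, lift_symbol, signMultilinear_apply]

/-- **«which carries l(−1)ⁿ to 1».** [cite: Milnor1970, §1 proof of Theorem 1.4 (p0003 L26–L39)] -/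
theorem signHomK_symbol_neg_one (P : RingPreordering F) (hP : ∀ a : F, a ∈ P ∨ -a ∈ P) :
    signHomK n P hP (symbol fun _ : Fin n => (-1 : Fˣ)) = 1 := by
  rw [signHomK_symbol]
  exact Finset.prod_eq_one fun j _ => sgnBit_neg_one P

/-- **THEOREM 1.4, `⇐`: if `−1` is not a sum of squares in `F` then `l(−1)ⁿ = {−1, …, −1} ≠ 0` in `K_nF` for every `n`** («This proves that the element l(−1) is not nilpotent»). [cite: Milnor1970, §1 Theorem 1.4 and its proof (p0003 L22–L39)] -/
theorem symbol_neg_one_ne_zero (h : ¬ IsSumSq (-1 : F)) (n : ℕ) : symbol (fun _ : Fin n => (-1 : Fˣ)) ≠ 0 := by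
  obtain ⟨P, hP⟩ := exists_total_ringPreordering h
  intro h0
  have := signHomK_symbol_neg_one (n := n) P hP
  rw [h0, map_zero] at this
  exact zero_ne_one this

/-! ### §3 THEOREM 1.4, `⇒`: `l(−1)` is nilpotent when `−1` is a sum of squares -/

/-- A sum of squares is a sum of squares of finitely many NON-ZERO elements (as «−1 = a₁² + ⋯ + a_r²» with `l(−aᵢ²)` defined). [cite: Milnor1970, §1 proof of Theorem 1.4 (p0003 L40–L45)] -/
theorem exists_sum_units_mul_self_of_isSumSq {s : F} (hs : IsSumSq s) :
    ∃ (r : ℕ) (a : Fin r → Fˣ), (∑ j, (a j : F) * a j) = s := by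
  induction hs with
  | zero => exact ⟨0, Fin.elim0, by simp⟩
  | sq_add x hs ih =>
    obtain ⟨r, a, ha⟩ := ih
    by_cases hx : x = 0
    · exact ⟨r, a, by rw [ha, hx, zero_mul, zero_add]⟩
    · refine ⟨r + 1, Fin.cons (Units.mk0 x hx) a, ?_⟩
      rw [Fin.sum_univ_succ, Fin.cons_zero, Units.val_mk0, ← ha]
      congr 1

/-- `{−a₁², …, −a_r²} ≡ {−1, …, −1} mod 2K_rF` (`l(−a²) = l(−1) + 2l(a)`): «hence l(−1)^r ≡ 0 mod 2K_rF». [cite: Milnor1970, §1 proof of Theorem 1.4 (p0003 L40–L45)] -/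
theorem exists_symbol_neg_mul_self_eq (r : ℕ) (a : Fin r → Fˣ) :
    ∃ x : MilnorK F r, symbol (fun j => -1 * (a j * a j)) = symbol (fun _ : Fin r => (-1 : Fˣ)) + (2 : ℤ) • x := by
  induction r with
  | zero =>
    refine ⟨0, ?_⟩
    rw [zsmul_zero, add_zero]
    congr 1; funext j; exact Fin.elim0 j
  | succ r ih =>
    obtain ⟨x, hx⟩ := ih (Fin.tail a)
    have hsplit : (fun j : Fin (r + 1) => -1 * (a j * a j)) =
        Fin.cons (-1 * (a 0 * a 0)) (fun j => -1 * (Fin.tail a j * Fin.tail a j)) := by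
      funext j; refine Fin.cases rfl (fun k => rfl) j
    have hneg : (fun _ : Fin (r + 1) => (-1 : Fˣ)) = Fin.cons (-1) (fun _ : Fin r => (-1 : Fˣ)) := by
      funext j; refine Fin.cases rfl (fun k => rfl) j
    refine ⟨cons (-1) x + cons (a 0) (symbol fun j => -1 * (Fin.tail a j * Fin.tail a j)), ?_⟩
    rw [hsplit, ← cons_symbol, cons_mul, cons_mul, hx, map_add, map_zsmul, hneg, ← cons_symbol, zsmul_add, ← two_zsmul]
    abel

/-- **«if −1 = a₁² + ⋯ + a_r², then it follows from 1.3 that l(−a₁²)⋯l(−a_r²) = 0; hence l(−1)^r ≡ 0 mod 2K_rF. Since 2l(−1) = 0, it follows immediately that l(−1)^{r+1} = 0.»** [cite: Milnor1970, §1 proof of Theorem 1.4 (p0003 L40–L45)] -/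
theorem symbol_neg_one_eq_zero_of_sum_eq {r : ℕ} (a : Fin r → Fˣ) (ha : (∑ j, (a j : F) * a j) = -1) :
    symbol (fun _ : Fin (r + 1) => (-1 : Fˣ)) = 0 := by
  -- `r ≥ 1`
  cases r with
  | zero => rw [Finset.univ_eq_empty, Finset.sum_empty] at ha; exact absurd ha.symm (by norm_num)
  | succ m =>
    -- Lemma 1.3: `{−a₁², …, −a_r²} = 0`
    have h13 : symbol (fun j => -1 * (a j * a j)) = 0 := by
      refine symbol_eq_zero_of_sum _ (Or.inr ?_)
      simp only [Units.val_mul, Units.val_neg, neg_one_mul, Finset.sum_neg_distrib, ha, neg_neg]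
    obtain ⟨x, hx⟩ := exists_symbol_neg_mul_self_eq (m + 1) a
    rw [h13, eq_comm, add_eq_zero_iff_eq_neg, ← zsmul_neg] at hx
    have hneg : (fun _ : Fin (m + 2) => (-1 : Fˣ)) = Fin.cons (-1) (fun _ : Fin (m + 1) => (-1 : Fˣ)) := by
      funext j; refine Fin.cases rfl (fun k => rfl) j
    rw [hneg, ← cons_symbol, hx, map_zsmul, two_smul_cons_neg_one]

/-- Once `l(−1)^r = 0`, all higher powers vanish. [cite: Milnor1970, §1 proof of Theorem 1.4 (p0003 L40–L45)] -/
theorem symbol_neg_one_eq_zero_of_le {r s : ℕ} (hrs : r ≤ s) (hr : symbol (fun _ : Fin r => (-1 : Fˣ)) = 0) :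
    symbol (fun _ : Fin s => (-1 : Fˣ)) = 0 := by
  obtain ⟨d, rfl⟩ := Nat.exists_eq_add_of_le hrs
  induction d with
  | zero => exact hr
  | succ d ih =>
    have hneg : (fun _ : Fin (r + (d + 1)) => (-1 : Fˣ)) = Fin.cons (-1) (fun _ : Fin (r + d) => (-1 : Fˣ)) := by
      funext j; refine Fin.cases rfl (fun k => rfl) j
    rw [hneg, ← cons_symbol, ih (Nat.le_add_right r d), map_zero]

/-- **THEOREM 1.4, `⇒`: if `−1` is a sum of squares then `l(−1)` is nilpotent: `{−1, …, −1} = 0` in some `K_{r+1}F`.** [cite: Milnor1970, §1 Theorem 1.4 and its proof (p0003 L22–L23, L40–L45)] -/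
theorem exists_symbol_neg_one_eq_zero (h : IsSumSq (-1 : F)) : ∃ r : ℕ, symbol (fun _ : Fin (r + 1) => (-1 : Fˣ)) = 0 := by
  obtain ⟨r, a, ha⟩ := exists_sum_units_mul_self_of_isSumSq h
  exact ⟨r, symbol_neg_one_eq_zero_of_sum_eq a ha⟩

/-- **THEOREM 1.4 (pivot form).** «The element −1 is a sum of squares in F if and only if every positive dimensional element of K_*F is nilpotent» — here: `−1` is a sum of squares iff `l(−1)` is nilpotent (`{−1, …, −1} = 0` in some positive degree); Milnor's proof derives the nilpotence of every positive-dimensional element from that of `l(−1)` through Lemma 1.2 (not formalised here, see the module docstring). [cite: Milnor1970, §1 Theorem 1.4 (p0003 L22–L23)] -/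
theorem isSumSq_neg_one_iff : IsSumSq (-1 : F) ↔ ∃ r : ℕ, symbol (fun _ : Fin (r + 1) => (-1 : Fˣ)) = 0 :=
  ⟨exists_symbol_neg_one_eq_zero, fun ⟨r, hr⟩ => by
    by_contra h
    exact symbol_neg_one_ne_zero h (r + 1) hr⟩

end MilnorK

end Literature.RingTheory.KTheory

end
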